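/-
Copyright: cell `pub-ymgap` (HUMAN RULING D-0062), Track A, DAG node N20; seat `pub-ymgap-dag-n20-d` (generation 4), module 2.
-/
import Summits.QuantumFields.YangMills.Theorems.BalabanUVNodesN20ChiSemantics
import HarnessLib

/-!
# YM-DAG node N20 (= NE7b): the χ_k(□) semantics KEYED TO def-R's CUBES — `□^{∼3}` lies in the top-scale constraint region of the (2.16)
# problem on `□^{∼4}` ([Balaban1988Convergent] p. 256 «Ω^{∼−2} ⊂ Ω_j» read on a cube collar), and module 4's `hsupp` from solvability
# of EXACTLY the local problems inside `χ_k` of record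

Track A of `YM-PLAN.md` (cell `pub-ymgap`, HUMAN RULING D-0062), node **N20** = NE7b (`T4WeightBudget.RelWeightBound`, NOT PRINTED, NOT PROVED).
Seat `pub-ymgap-dag-n20-d` (director-ym R134), generation 4, module 2 (module 1: `…Theorems.BalabanUVNodesN20ChiSemantics` — the (2.16) problem of
record is solvable only at locally regular data; `χ_k(□) = 1` by junk off the solvable set; `hsupp` ⇐ solvability for an abstract cover).  Kernel
theorems only (0 `def`, 0 `sorry`, standard axioms); COUNT-NEUTRAL (`--supports stmt-QuantumFields-19908 --as helper`).

CONTENT.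
* §1 GEOMETRY OF THE COVER: on the universal cover, the `nS`-collar of an `S`-cube lies two `s`-cube layers inside its `(n+1)S`-collar once
  `3s ≤ S` (`cubeExt_subset_innerN_cubeExt`); on the torus, with r11's «Ω^{∼−2} ⊂ Ω_j» (`B14.Eq213DetSet.innerTwoT_subset_maxDomT`):
  **`cubeEnl P S a n ⊆ maxDomT M₁ (cubeEnl P S a (n+1)) k`** whenever `3·L^k·M₁ ≤ S` (`cubeEnl_subset_maxDomT_cubeEnl_succ`), hence
  `pts k □^{∼n} ⊆ pts k ((□^{∼(n+1)})_k)` (`pts_cubeEnl_subset`): at `n = 3`, every `k`-site whose iterated centre lies in `□^{∼3}` meets the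
  top-scale member `Γ_k` of `𝐁_k(□^{∼4})` — the region where module 1's `iter_ukBox_eq_of_mem_bondsOf` reads `M^k(U_{k,□}(V)) = V`.
* §2 **MODULE 4's `hsupp` FROM SOLVABILITY OF THE (2.16) PROBLEMS INSIDE `χ_k` OF RECORD** (`lcs_piece_tstepOfRecord_expPlaqSum_bySolvability_cubes`):
  module 1's `…_bySolvability` with boxes := the enlarged cubes `cubeEnl (F.P K) S a 4` of the step-`k` partition of record (`S = cubeSide L M₂ R_k k`,
  `R_k = RkOfRecord L r g_k`), threshold `εreg`, width `M₁` — EXACTLY the local backgrounds inside def-R's `chiSeqOfRecord`; the cover hypothesis is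
  now purely positional (`hcover3`: the three corners of every level-`k` plaquette of the boxes around `Q` have iterated centres in some `□^{∼3}`), under
  the numeric side condition `3·L^k·M₁ ≤ L^{k+1}·M₂·R_k` of the stage-₇ numerics; solvability on the support stays the (H-U)-shaped hypothesis.

HONEST FRAMING.  Count-neutral kernel bookkeeping (integer box arithmetic + r11's landed torus lemma).  Solvability is a HYPOTHESIS
([Balaban1985PropagatorsII] Thm 1 NOT asserted); nothing of Bałaban's asserted; NE7b NOT PRINTED ∕ NOT PROVED; (α)-instance 0∕1; N20 NOT discharged;
typed 28∕28, count untouched; one finite torus at fixed `ε` — NOT ℝ⁴ ∕ infinite volume ∕ OS ∕ mass gap ∕ Clay.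
References: T. Bałaban, CMP 119 (1988) 243–285 [Balaban1988Convergent] ((2.13) pp.256–257, (2.16)–(2.17) p.257, p.267); CMP 122 (1989) 355–392
[Balaban1989LargeFieldII] (p.383 l.21–28); CMP 98 (1985) 17–51 [Balaban1985Averaging] (Prop. 2 (54) p.26).
-/

noncomputable section

open scoped BigOperators Matrix.Norms.L2Operator

namespace Summit.QuantumFields.YangMills.BalabanUVNodes.N20ChiSemanticsCubes

open MeasureTheory
open Literature.MathematicalPhysics.QuantumFieldTheory.Balaban1983to89
open Literature.MathematicalPhysics.QuantumFieldTheory.Balaban1983to89.T4Continuum (T4Family)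
open Literature.MathematicalPhysics.QuantumFieldTheory.Balaban1983to89.Node00
open B15DeterminingSets B14.Eq213DetSet B14.Eq216Concrete B14.Eq218Concrete B15Eq112TorusCover
open ExpMeanLog (deltaSU)
open Literature.MathematicalPhysics.QuantumFieldTheory.BalabanImbrieJaffe1984to88.BIJ85Eq453GaugeField (qsstarGIter0)
open Summit.QuantumFields.YangMills.BalabanUVNodes.N20LCSAvgDominationRegion (boxRegion)
open Summit.QuantumFields.YangMills.BalabanUVNodes.N20ChiSemantics (lcs_piece_tstepOfRecord_expPlaqSum_bySolvability)

/-! ## §1 The cover: `□^{∼n} ⊆ (□^{∼(n+1)})_k`, so the top-scale constraint region of `□^{∼4}` corners `□^{∼3}` -/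

section Cover

open B14DomainGeom (innerN innerN_mono cubeIdx cubeIdx_le lt_cubeIdx IdxNear)
open B14.Eq213MaximalDomains (side side_pos cubeExt)

/-- On the universal cover: the `nS`-collar of an `S`-cube lies TWO `s`-cube layers inside its `(n+1)S`-collar as soon as `3s ≤ S`
(`|cubeIdx s x − cubeIdx s y| ≤ 2 ⇒ |x − y| ≤ 3s − 1`). [cite: Balaban1988Convergent, (2.13) pp.256–257] -/
theorem cubeExt_subset_innerN_cubeExt {d : ℕ} (S s : ℕ) (hs : 0 < s) (h3 : 3 * s ≤ S) (a : B14DomainGeom.Pt d) (n : ℕ) :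
    cubeExt S a ((n * S : ℕ) : ℤ) ⊆ innerN s 2 (cubeExt S a (((n + 1) * S : ℕ) : ℤ)) := by
  intro x hx
  have hS : ((3 * s : ℕ) : ℤ) ≤ (S : ℤ) := by exact_mod_cast h3
  push_cast at hS
  refine ⟨fun i => ?_, fun y hy i => ?_⟩
  · obtain ⟨h₁, h₂⟩ := hx i
    push_cast at h₁ h₂ ⊢
    have hs0 : (0 : ℤ) ≤ s := by exact_mod_cast hs.le
    constructor <;> nlinarith
  · obtain ⟨h₁, h₂⟩ := hx i
    have hxy := abs_le.1 (hy i)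
    push_cast at hxy
    have e₁ := cubeIdx_le s hs x i
    have e₂ := lt_cubeIdx s hs x i
    have e₃ := cubeIdx_le s hs y i
    have e₄ := lt_cubeIdx s hs y i
    have hs0 : (0 : ℤ) ≤ s := by exact_mod_cast hs.le
    have e₅ : (s : ℤ) * (cubeIdx s x i - 2) ≤ (s : ℤ) * cubeIdx s y i := mul_le_mul_of_nonneg_left (by linarith) hs0
    have e₆ : (s : ℤ) * cubeIdx s y i ≤ (s : ℤ) * (cubeIdx s x i + 2) := mul_le_mul_of_nonneg_left (by linarith) hs0
    push_cast at h₁ h₂ ⊢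
    constructor <;> nlinarith

/-- **`□^{∼n} ⊆ (□^{∼(n+1)})_k` ON THE TORUS**: the `n`-fold enlargement of an `S`-cube of the fine torus lies in the `k`-th maximal domain of its
`(n+1)`-fold enlargement whenever `3·L^k M₁ ≤ S` (r11's «Ω^{∼−2} ⊂ Ω_j», `B14.Eq213DetSet.innerTwoT_subset_maxDomT`, read on a cube collar); at
`n = 3`: the top-scale constraint region of the (2.16) problem on `□^{∼4}` contains every `k`-site whose iterated centre lies in `□^{∼3}`.
[cite: Balaban1988Convergent, (2.13) pp.256–257, (2.16) p.257] -/
theorem cubeEnl_subset_maxDomT_cubeEnl_succ (P : Params) {M₁ : ℕ} (hM : 1 ≤ M₁) {S k : ℕ} (h3 : 3 * side P.L M₁ k ≤ S)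
    (a : B14DomainGeom.Pt P.d) (n : ℕ) : cubeEnl P S a n ⊆ maxDomT M₁ (cubeEnl P S a (n + 1)) k := by
  refine Set.Subset.trans ?_ (innerTwoT_subset_maxDomT hM _ k)
  unfold cubeEnl innerTwoT
  exact Set.image_mono ((cubeExt_subset_innerN_cubeExt S _ (side_pos P.L_pos hM k) h3 a n).trans
    (innerN_mono _ _ (Set.subset_preimage_image _ _)))

/-- Hence `pts k □^{∼n} ⊆ pts k ((□^{∼(n+1)})_k)`: a `k`-site whose iterated centre lies in `□^{∼n}` meets the top-scale member of `𝐁_k(□^{∼(n+1)})`.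
[cite: Balaban1988Convergent, (2.13) pp.256–257] -/
theorem pts_cubeEnl_subset (P : Params) {M₁ : ℕ} (hM : 1 ≤ M₁) {S k : ℕ} (h3 : 3 * side P.L M₁ k ≤ S)
    (a : B14DomainGeom.Pt P.d) (n : ℕ) : pts k (cubeEnl P S a n) ⊆ pts k (maxDomT M₁ (cubeEnl P S a (n + 1)) k) :=
  Set.preimage_mono (cubeEnl_subset_maxDomT_cubeEnl_succ P hM h3 a n)

end Cover


/-! ## §2 Module 4's `hsupp` from solvability of the (2.16) problems inside `χ_k` of record -/

section Junction

open B14.Eq213MaximalDomains (side)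

variable (F : T4Family) (N : ℕ) [NeZero N] (ν : Stage7Numerics) (Mν : ℕ) (w : StepWeightsOfRecord F N ν Mν)
  (p : B12.RunParams) (g : ℕ → ℝ) (k : ℕ)

/-- **THE SAME KEYED TO def-R's CUBES.**  Boxes := the enlarged cubes `□^{∼4} = cubeEnl (F.P K) S a 4` of the step-`k` partition of record
(`S = cubeSide L M₂ R_k k`, `R_k = RkOfRecord L r g_k`), regularity threshold `εreg`, determining-set width `M₁` — EXACTLY the (2.16) problems
inside `χ_k` of record; the cover hypothesis becomes purely positional (`hcover3`: every level-`k` plaquette of the boxes around `Q` has its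
three corners' iterated centres in some `□^{∼3}`), by §4 under the numeric side condition `3·L^k·M₁ ≤ S`; solvability on the support as before.
[cite: Balaban1989LargeFieldII, p.383; Balaban1988Convergent, (2.16)–(2.17) p.257, p.267] -/
theorem lcs_piece_tstepOfRecord_expPlaqSum_bySolvability_cubes (hk : k < p.K)
    (T : SeqOfRecord F ν Mν g p.K k → Density (F.P p.K) k (SU N)) (s' : SeqOfRecord F ν Mν g p.K (k + 1))
    (hT : Integrable (fun U => chiSeqOfRecord F N ν Mν g p.K k s'.init U * T s'.init U) (fieldMeasure (F.P p.K) k (SU N)))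
    (hw : Measurable
      (fun z : GaugeField (F.P p.K) (k + 1) (SU N) × GaugeField (F.P p.K) k (SU N) => w p g k s' z.2 z.1))
    (hwb : ∀ U V', |w p g k s' U V'| ≤ 1) (hχ : Measurable (chiSeqOfRecord F N ν Mν g p.K (k + 1) s'))
    (h0 : ∀ U, 0 ≤ (chiSeqOfRecord F N ν Mν g p.K (k + 1) s' ((avOfRecord F N p.K k).avg U) *
        w p g k s' U ((avOfRecord F N p.K k).avg U)) * (chiSeqOfRecord F N ν Mν g p.K k s'.init U * T s'.init U))
    (Q : Finset (Plaq (F.P p.K) (k + 1))) {t : ℝ} (ht0 : 0 ≤ t) (hε : 0 < ν.εreg)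
    (hε3 : (143 * (((((F.P p.K).d + 4 : ℕ) : ℝ)) ^ 2 / 4) ^ 2) * ν.εreg ≤ 1 / 3)
    (hε2 : 2 * ν.εreg ≤ 2 * deltaSU (Fin N) / ((((F.P p.K).d + 4) * (F.P p.K).L : ℕ) : ℝ) ^ 2)
    (hguard : (((((F.P p.K).d + 2) * (F.P p.K).L : ℕ) : ℝ) ^ 2 / 4) * (2 * ν.εreg) < deltaSU (Fin N))
    (hM : 1 ≤ ν.M₁) (hS : 3 * side (F.P p.K).L ν.M₁ k ≤ cubeSide (F.P p.K).L ν.M₂ (RkOfRecord (F.P p.K).L ν.r (g k)) k)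
    (hcover3 : ∀ p' ∈ Q, ∀ q ∈ boxRegion (emb p'.src) (((F.P p.K).d + 3) * (F.P p.K).L + 2), ∃ a : B14DomainGeom.Pt (F.P p.K).d,
      q.src ∈ pts k (cubeEnl (F.P p.K) (cubeSide (F.P p.K).L ν.M₂ (RkOfRecord (F.P p.K).L ν.r (g k)) k) a 3) ∧
      q.src.shift q.μ ∈ pts k (cubeEnl (F.P p.K) (cubeSide (F.P p.K).L ν.M₂ (RkOfRecord (F.P p.K).L ν.r (g k)) k) a 3) ∧
      q.src.shift q.ν ∈ pts k (cubeEnl (F.P p.K) (cubeSide (F.P p.K).L ν.M₂ (RkOfRecord (F.P p.K).L ν.r (g k)) k) a 3))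
    (hsolv : ∀ U, (chiSeqOfRecord F N ν Mν g p.K (k + 1) s' ((avOfRecord F N p.K k).avg U) *
        w p g k s' U ((avOfRecord F N p.K k).avg U)) * (chiSeqOfRecord F N ν Mν g p.K k s'.init U * T s'.init U) ≠ 0 →
        ∀ a : B14DomainGeom.Pt (F.P p.K).d, ∃ U₀, IsMinimizer (avOfRecord F N p.K) {W | PlaqSmall (ν.εreg * (F.P p.K).eta k ^ 2) W}
          (Bj ν.M₁ (cubeEnl (F.P p.K) (cubeSide (F.P p.K).L ν.M₂ (RkOfRecord (F.P p.K).L ν.r (g k)) k) a 4) k)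
          (avgFamily (avOfRecord F N p.K) (qsstarGIter0 k U)) U₀) :
    ∫ V', Real.exp (t * ∑ p' ∈ Q, (1 - reTr (GaugeField.plaqHol V' p'))) *
          (chiSeqOfRecord F N ν Mν g p.K (k + 1) s' V' * tstepOfRecord F N ν Mν w p g k T s' V')
        ∂(fieldMeasure (F.P p.K) (k + 1) (SU N)) ≤
      Real.exp (t * (((((F.P p.K).L : ℝ) ^ 2 + 6 * ((((F.P p.K).d + 2) * (F.P p.K).L : ℕ) : ℝ) ^ 2) * (2 * ν.εreg)) ^ 2 * Q.card)) *
        ∫ V', chiSeqOfRecord F N ν Mν g p.K (k + 1) s' V' * tstepOfRecord F N ν Mν w p g k T s' V'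
          ∂(fieldMeasure (F.P p.K) (k + 1) (SU N)) := by
  refine lcs_piece_tstepOfRecord_expPlaqSum_bySolvability F N ν Mν w p g k hk T s' hT hw hwb hχ h0 Q ht0 hε hε3 hε2 hguard ν.M₁
    (fun a : B14DomainGeom.Pt (F.P p.K).d => cubeEnl (F.P p.K) (cubeSide (F.P p.K).L ν.M₂ (RkOfRecord (F.P p.K).L ν.r (g k)) k) a 4)
    (fun p' hp' q hq => ?_) hsolv
  obtain ⟨a, h₁, h₂, h₃⟩ := hcover3 p' hp' q hq
  have hsub := pts_cubeEnl_subset (F.P p.K) hM hS a 3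
  exact ⟨a, hsub h₁, hsub h₂, hsub h₃⟩

end Junction

end Summit.QuantumFields.YangMills.BalabanUVNodes.N20ChiSemanticsCubes

end
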